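import Summits.QuantumFields.YangMills.Theorems.LangevinControlUVOSLegsAtWeakCouplingCInheritedAmplitudeGatesDefs
import Summits.QuantumFields.YangMills.Theorems.LangevinControlUVOSLegsFromFemtoAndGapStubLowerCube
import Summits.QuantumFields.YangMills.Theorems.LangevinControlUVOSLegsFromFemtoAndGapStubCollar6
import Literature.Probability.LatticeModels.TwoPointLogConvex
import HarnessLib

/-!
# Stub `stub_inherit` of line `inherited-amplitude-gates` (crux `OSLegsAtWeakCouplingC`, stmt-QuantumFields-16207):
# auxiliary file 1 — the femto torus around a general cube, for single-plane fields

The inheritance lemma `stub_inherit` reads H1 (the femto two-point package, stated for Wilson's measure on a torus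
`GaugeConfig 4 T G` in the presentation `P x i j U = N − Re tr r(U_{x,ij})`) on a torus of side `T ≥ b + 3`
containing a GIVEN cube `(c, b)` of `ℤ⁴`, and transports it to the cube kernel `kerE`/`kerCov` of the route Defs
through the law of total covariance.  This file supplies the torus-side bookkeeping, for single-plane fields
`plane G r q y` at sites of the cube:

* `plane_torusLift`, `plane_add_apply`: the plane field read through the periodic lift / translated;
* `integral_lift_configShift`: torus Wilson expectations of lifted observables are translation invariant;
* `h1Cov_eq_liftCov`: H1's torus covariance `cov (P 0 0 1) (P (m e₂) 0 1)` equals the covariance of the lifted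
  plane fields at ANY axis pair `(x', x' + m e₂)` (translation invariance; the constants `N` cancel);
* `integral_lift_eq_integral_kerE_cube`: the one-cube torus DLR step for a general cube `(c, b)` inside a torus of
  side `T ≥ b + 3` (window form of the tree's `wilsonExpectation_toTorusObservable_eq`);
* `abs_cov_sub_integral_condCov_le`: the law of total covariance as a TWO-SIDED estimate
  `|Cov_T(F, F') − E_T[kerCov_η(F, F')]| ≤ 4 h h'` under the boundary laws `|kerE_η F − p| ≤ h`, `|kerE_η F' − p'| ≤ h'`;
* `abs_liftCov_plane_sub_integral_kerCov_le`: the same assembled for two plane fields of the cube.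

Refs: Georgii 2011 Thm. 4.17 (DLR kernels); Friedli–Velenik 2017 (6.34); line card
`Cruxes/OSLegsAtWeakCouplingC/Lines/inherited-amplitude-gates.md` (stub_inherit, steps (i)–(ii)).
-/

set_option autoImplicit false

noncomputable section

open scoped BigOperators
open MeasureTheory Filter Topology
open Literature.MathematicalPhysics.QuantumFieldTheory Literature.MathematicalPhysics.QuantumLattice
open Literature.MathematicalPhysics.AQFT Literature.Probability.LatticeModels
open Summit.QuantumFields.YangMills.Cruxes.OSLegsFromFemtoAndGap.DlrCollarTransfer
open Summit.QuantumFields.YangMills.Cruxes.OSLegsFromFemtoAndGap.DlrCollarTransfer.StubLower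
open Summit.QuantumFields.YangMills.Theorems.OSLegsFromFemtoAndGap.StubLower

namespace Summit.QuantumFields.YangMills.Cruxes.OSLegsAtWeakCouplingC.InheritedAmplitudeGates.StubInherit

/-! ### A two-sided law of total covariance on a compact probability space -/

section Moments

variable {Ω : Type*} [TopologicalSpace Ω] [CompactSpace Ω] [MeasurableSpace Ω]
  [OpensMeasurableSpace Ω] {μ : Measure Ω} [IsProbabilityMeasure μ]

/-- **Law of total covariance, two-sided.**  With (continuous) conditional expectations `gAB, gA, gB` of
`AB, A, B` given the exterior and the boundary laws `|gA − p| ≤ h`, `|gB − q| ≤ h'`, the total covariance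
`∫ gAB − (∫ gA)(∫ gB)` is within `4 h h'` of the mean conditional covariance `∫ (gAB − gA gB)`. [folklore] -/
theorem abs_cov_sub_integral_condCov_le {gA gB gAB : Ω → ℝ} (hA : Continuous gA) (hB : Continuous gB)
    (hAB : Continuous gAB) {p q h h' : ℝ} (hdA : ∀ ω, |gA ω - p| ≤ h) (hdB : ∀ ω, |gB ω - q| ≤ h') :
    |(∫ ω, gAB ω ∂μ - (∫ ω, gA ω ∂μ) * (∫ ω, gB ω ∂μ)) - ∫ ω, (gAB ω - gA ω * gB ω) ∂μ| ≤ 4 * h * h' := by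
  set mA := ∫ ω, gA ω ∂μ with hmA
  set mB := ∫ ω, gB ω ∂μ with hmB
  have hpA : |mA - p| ≤ h := abs_integral_sub_const_le hA hdA
  have hpB : |mB - q| ≤ h' := abs_integral_sub_const_le hB hdB
  have hdevA : ∀ ω, |gA ω - mA| ≤ 2 * h := fun ω => by
    have : gA ω - mA = (gA ω - p) - (mA - p) := by ring
    rw [this]
    exact (abs_sub _ _).trans (by linarith [hdA ω])
  have hdevB : ∀ ω, |gB ω - mB| ≤ 2 * h' := fun ω => by
    have : gB ω - mB = (gB ω - q) - (mB - q) := by ring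
    rw [this]
    exact (abs_sub _ _).trans (by linarith [hdB ω])
  have iA : Integrable gA μ := integrable_of_continuous_compact hA
  have iB : Integrable gB μ := integrable_of_continuous_compact hB
  have iAB : Integrable gAB μ := integrable_of_continuous_compact hAB
  have iAgB : Integrable (fun ω => gA ω * gB ω) μ := integrable_of_continuous_compact (hA.mul hB)
  have iprod : Integrable (fun ω => (gA ω - mA) * (gB ω - mB)) μ :=
    integrable_of_continuous_compact ((hA.sub continuous_const).mul (hB.sub continuous_const))
  -- the difference is the covariance of the conditional means
  have hsplit : (∫ ω, gAB ω ∂μ - mA * mB) - ∫ ω, (gAB ω - gA ω * gB ω) ∂μ =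
      ∫ ω, (gA ω - mA) * (gB ω - mB) ∂μ := by
    have e : (fun ω => (gA ω - mA) * (gB ω - mB)) =
        fun ω => (gA ω * gB ω - mA * gB ω - mB * gA ω) + mA * mB := by
      funext ω; ring
    have i1 : Integrable (fun ω => gA ω * gB ω - mA * gB ω) μ := iAgB.sub (iB.const_mul mA)
    have i2 : Integrable (fun ω => gA ω * gB ω - mA * gB ω - mB * gA ω) μ := i1.sub (iA.const_mul mB)
    rw [e, integral_add i2 (integrable_const _), integral_sub i1 (iA.const_mul mB),
      integral_sub iAgB (iB.const_mul mA), integral_const_mul, integral_const_mul, integral_const,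
      integral_sub iAB iAgB]
    simp only [probReal_univ, smul_eq_mul, one_mul]
    ring
  rw [hsplit, ← Real.norm_eq_abs]
  have hpt : ∀ ω, ‖(gA ω - mA) * (gB ω - mB)‖ ≤ 4 * h * h' := fun ω => by
    rw [Real.norm_eq_abs, abs_mul]
    have := mul_le_mul (hdevA ω) (hdevB ω) (abs_nonneg _) ((abs_nonneg _).trans (hdevA ω))
    linarith
  have := norm_integral_le_of_norm_le_const (μ := μ) (ae_of_all _ hpt)
  simpa using this

/-- Averaging a uniform estimate: if `|g ω − K| ≤ Δ` for every `ω` then `|∫ g − K| ≤ Δ`. [folklore] -/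
theorem abs_integral_sub_le_of_forall {g : Ω → ℝ} (hg : Continuous g) {K Δ : ℝ}
    (h : ∀ ω, |g ω - K| ≤ Δ) : |∫ ω, g ω ∂μ - K| ≤ Δ :=
  abs_integral_sub_const_le hg h

end Moments

/-! ### Single-plane fields through the periodic lift; translations -/

section Plane

variable (G : Type) [Group G] [TopologicalSpace G] [IsTopologicalGroup G] [CompactSpace G]
  [MeasurableSpace G] [BorelSpace G] (r : LatticeRep G)

omit [IsTopologicalGroup G] [CompactSpace G] [BorelSpace G] in
/-- The plane field at `y` read on the periodic lift of a torus configuration is the torus plaquette field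
below `y`. [folklore] -/
theorem plane_torusLift (T : ℕ) (q : Fin 4 × Fin 4) (y : Fin 4 → ℤ) (U : GaugeConfig 4 T G) :
    plane G r q y (torusLift T U) = (r.ρ (plaquetteHolonomy U (Torus.proj T y) q.1 q.2)).trace.re := by
  unfold plane plaquetteObs
  congr 3
  simp only [plaquetteHolonomyZd, plaquetteHolonomy, torusLift, torusEdge, Function.comp_apply,
    Literature.MathematicalPhysics.QuantumFieldTheory.Site.shift,
    Literature.MathematicalPhysics.QuantumLattice.configShift_apply, sub_neg_eq_add, zero_add, Torus.proj_add,
    Torus.proj_single, Int.cast_one, add_comm (Pi.single _ _) y]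

omit [IsTopologicalGroup G] [CompactSpace G] [BorelSpace G] in
/-- Translating the site translates the configuration: `plane q (z + w) U = plane q z (θ_{−w} U)`. [folklore] -/
theorem plane_add_apply (q : Fin 4 × Fin 4) (z w : Fin 4 → ℤ) (U : LGConfig 4 G) :
    plane G r q (z + w) U = plane G r q z (Literature.MathematicalPhysics.QuantumLattice.configShift (-w) U) := by
  unfold plane plaquetteObs plaquetteHolonomyZd
  simp only [Literature.MathematicalPhysics.QuantumLattice.configShift_apply, sub_neg_eq_add, add_assoc]

/-- **Translation invariance of lifted expectations.**  For every observable `F` of `ℤ⁴`-configurations and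
every `v`, `∫ F(θ_v (lift U)) dμ_T = ∫ F(lift U) dμ_T` under Wilson's torus measure. [folklore] -/
theorem integral_lift_configShift (T : ℕ) [NeZero T] (β : ℝ) (v : Fin 4 → ℤ) (F : LGConfig 4 G → ℝ) :
    ∫ U, F (Literature.MathematicalPhysics.QuantumLattice.configShift v (torusLift T U))
        ∂(wilsonMeasure (d := 4) (L := T) r.ρ β) =
      ∫ U, F (torusLift T U) ∂(wilsonMeasure (d := 4) (L := T) r.ρ β) := by
  have h := toTorusObservable_comp_configShift (G := G) T v F
  have h' : (fun U : GaugeConfig 4 T G => F (Literature.MathematicalPhysics.QuantumLattice.configShift v (torusLift T U))) =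
      (fun U : GaugeConfig 4 T G => F (torusLift T U)) ∘ torusConfigShift (Torus.proj T v) := by
    funext U
    have := congrArg (fun f => f U) h
    simpa only [toTorusObservable, Function.comp_apply] using this
  have key := wilsonExpectation_comp_torusConfigShift (d := 4) (L := T) r.ρ β (Torus.proj T v)
    (fun U : GaugeConfig 4 T G => F (torusLift T U))
  unfold wilsonExpectation at key
  rw [← h'] at key
  exact key

/-- Integrability of a continuous bounded-type observable read through the lift (compactness). [folklore] -/
theorem integrable_lift {T : ℕ} [NeZero T] (β : ℝ) {F : LGConfig 4 G → ℝ} (hF : Continuous F) :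
    Integrable (fun U : GaugeConfig 4 T G => F (torusLift T U)) (wilsonMeasure (d := 4) (L := T) r.ρ β) := by
  haveI := r.secondCountableTopology
  haveI := isProbabilityMeasure_wilsonMeasure (d := 4) (L := T) r.ρ r.continuous β
  exact integrable_of_continuous_compact (hF.comp (continuous_torusLift _))

/-- **The lifted covariance is translation invariant**: `Cov(plane q (z+w), plane q' (z'+w)) = Cov(plane q z, plane q' z')`. [folklore] -/
theorem liftCov_plane_add (β : ℝ) (T : ℕ) [NeZero T] (q q' : Fin 4 × Fin 4) (z z' w : Fin 4 → ℤ) :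
    ((∫ U, plane G r q (z + w) (torusLift T U) * plane G r q' (z' + w) (torusLift T U) ∂(wilsonMeasure (d := 4) (L := T) r.ρ β)) -
        (∫ U, plane G r q (z + w) (torusLift T U) ∂(wilsonMeasure (d := 4) (L := T) r.ρ β)) *
          (∫ U, plane G r q' (z' + w) (torusLift T U) ∂(wilsonMeasure (d := 4) (L := T) r.ρ β))) =
      ((∫ U, plane G r q z (torusLift T U) * plane G r q' z' (torusLift T U) ∂(wilsonMeasure (d := 4) (L := T) r.ρ β)) -
        (∫ U, plane G r q z (torusLift T U) ∂(wilsonMeasure (d := 4) (L := T) r.ρ β)) *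
          (∫ U, plane G r q' z' (torusLift T U) ∂(wilsonMeasure (d := 4) (L := T) r.ρ β))) := by
  have e1 : (fun U : GaugeConfig 4 T G => plane G r q (z + w) (torusLift T U) * plane G r q' (z' + w) (torusLift T U)) =
      fun U => (fun V => plane G r q z V * plane G r q' z' V)
        (Literature.MathematicalPhysics.QuantumLattice.configShift (-w) (torusLift T U)) := by
    funext U; simp only [plane_add_apply]
  have e2 : (fun U : GaugeConfig 4 T G => plane G r q (z + w) (torusLift T U)) =
      fun U => plane G r q z (Literature.MathematicalPhysics.QuantumLattice.configShift (-w) (torusLift T U)) := by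
    funext U; simp only [plane_add_apply]
  have e3 : (fun U : GaugeConfig 4 T G => plane G r q' (z' + w) (torusLift T U)) =
      fun U => plane G r q' z' (Literature.MathematicalPhysics.QuantumLattice.configShift (-w) (torusLift T U)) := by
    funext U; simp only [plane_add_apply]
  rw [e1, e2, e3, integral_lift_configShift G r T β (-w) (fun V => plane G r q z V * plane G r q' z' V),
    integral_lift_configShift G r T β (-w) (plane G r q z),
    integral_lift_configShift G r T β (-w) (plane G r q' z')]

/-- **H1's torus covariance is the lifted plane covariance at any axis pair.**  For the torus of side `T`,
the covariance of `P 0 0 1` and `P (m e₂) 0 1` (`P x i j U = N − Re tr r(U_{x,ij})`, Wilson expectation at `β`)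
equals `liftCov` of the `(0,1)`-plane fields at `x'` and `x' + m e₂`, for every `x'`. [folklore] -/
theorem h1Cov_eq_liftCov (β : ℝ) (T : ℕ) [NeZero T] (m : ℕ) (x' : Fin 4 → ℤ) :
    (wilsonExpectation (d := 4) (L := T) r.ρ β
        (fun U => ((r.N : ℝ) - (r.ρ (plaquetteHolonomy U 0 0 1)).trace.re) *
          ((r.N : ℝ) - (r.ρ (plaquetteHolonomy U (Pi.single (2 : Fin 4) ((m : ℕ) : ZMod T)) 0 1)).trace.re)) -
      wilsonExpectation (d := 4) (L := T) r.ρ β (fun U => (r.N : ℝ) - (r.ρ (plaquetteHolonomy U 0 0 1)).trace.re) *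
        wilsonExpectation (d := 4) (L := T) r.ρ β
          (fun U => (r.N : ℝ) - (r.ρ (plaquetteHolonomy U (Pi.single (2 : Fin 4) ((m : ℕ) : ZMod T)) 0 1)).trace.re)) =
      ((∫ U, plane G r (0, 1) x' (torusLift T U) * plane G r (0, 1) (x' + Pi.single (2 : Fin 4) (m : ℤ)) (torusLift T U) ∂(wilsonMeasure (d := 4) (L := T) r.ρ β)) -
        (∫ U, plane G r (0, 1) x' (torusLift T U) ∂(wilsonMeasure (d := 4) (L := T) r.ρ β)) *
          (∫ U, plane G r (0, 1) (x' + Pi.single (2 : Fin 4) (m : ℤ)) (torusLift T U) ∂(wilsonMeasure (d := 4) (L := T) r.ρ β))) := by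
  haveI := r.secondCountableTopology
  haveI := isProbabilityMeasure_wilsonMeasure (d := 4) (L := T) r.ρ r.continuous β
  -- move the axis pair to the origin
  have hshift := liftCov_plane_add G r β T (0, 1) (0, 1) 0 (Pi.single (2 : Fin 4) (m : ℤ)) x'
  rw [zero_add, add_comm] at hshift
  rw [hshift]
  -- identify the torus plaquette fields with the lifted plane fields
  have h0 : Torus.proj T (0 : Fin 4 → ℤ) = 0 := funext fun i => by simp
  have hA : ∀ U : GaugeConfig 4 T G, (r.ρ (plaquetteHolonomy U 0 0 1)).trace.re =
      plane G r (0, 1) 0 (torusLift T U) := fun U => by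
    rw [plane_torusLift, h0]
  have hB : ∀ U : GaugeConfig 4 T G,
      (r.ρ (plaquetteHolonomy U (Pi.single (2 : Fin 4) ((m : ℕ) : ZMod T)) 0 1)).trace.re =
        plane G r (0, 1) (Pi.single (2 : Fin 4) (m : ℤ)) (torusLift T U) := fun U => by
    rw [plane_torusLift, Torus.proj_single, Int.cast_natCast]
  have e1 : (fun U : GaugeConfig 4 T G => ((r.N : ℝ) - (r.ρ (plaquetteHolonomy U 0 0 1)).trace.re) *
      ((r.N : ℝ) - (r.ρ (plaquetteHolonomy U (Pi.single (2 : Fin 4) ((m : ℕ) : ZMod T)) 0 1)).trace.re)) =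
      fun U => (plane G r (0, 1) 0 (torusLift T U) * plane G r (0, 1) (Pi.single (2 : Fin 4) (m : ℤ)) (torusLift T U)
        - (r.N : ℝ) * plane G r (0, 1) 0 (torusLift T U)
        - (r.N : ℝ) * plane G r (0, 1) (Pi.single (2 : Fin 4) (m : ℤ)) (torusLift T U)) + (r.N : ℝ) * (r.N : ℝ) := by
    funext U; rw [hA U, hB U]; ring
  have e2 : (fun U : GaugeConfig 4 T G => (r.N : ℝ) - (r.ρ (plaquetteHolonomy U 0 0 1)).trace.re) =
      fun U => (r.N : ℝ) - plane G r (0, 1) 0 (torusLift T U) := by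
    funext U; rw [hA U]
  have e3 : (fun U : GaugeConfig 4 T G =>
      (r.N : ℝ) - (r.ρ (plaquetteHolonomy U (Pi.single (2 : Fin 4) ((m : ℕ) : ZMod T)) 0 1)).trace.re) =
      fun U => (r.N : ℝ) - plane G r (0, 1) (Pi.single (2 : Fin 4) (m : ℤ)) (torusLift T U) := by
    funext U; rw [hB U]
  have iA : Integrable (fun U : GaugeConfig 4 T G => plane G r (0, 1) 0 (torusLift T U))
      (wilsonMeasure (d := 4) (L := T) r.ρ β) := integrable_lift G r β (continuous_plane r _ _)
  have iB : Integrable (fun U : GaugeConfig 4 T G => plane G r (0, 1) (Pi.single (2 : Fin 4) (m : ℤ)) (torusLift T U))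
      (wilsonMeasure (d := 4) (L := T) r.ρ β) := integrable_lift G r β (continuous_plane r _ _)
  have iAB : Integrable (fun U : GaugeConfig 4 T G =>
      plane G r (0, 1) 0 (torusLift T U) * plane G r (0, 1) (Pi.single (2 : Fin 4) (m : ℤ)) (torusLift T U))
      (wilsonMeasure (d := 4) (L := T) r.ρ β) :=
    integrable_lift G r β (F := fun V => plane G r (0, 1) 0 V * plane G r (0, 1) (Pi.single (2 : Fin 4) (m : ℤ)) V)
      ((continuous_plane r _ _).mul (continuous_plane r _ _))
  have i1 : Integrable (fun U : GaugeConfig 4 T G =>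
      plane G r (0, 1) 0 (torusLift T U) * plane G r (0, 1) (Pi.single (2 : Fin 4) (m : ℤ)) (torusLift T U)
        - (r.N : ℝ) * plane G r (0, 1) 0 (torusLift T U)) (wilsonMeasure (d := 4) (L := T) r.ρ β) :=
    iAB.sub (iA.const_mul (r.N : ℝ))
  have i2 : Integrable (fun U : GaugeConfig 4 T G =>
      plane G r (0, 1) 0 (torusLift T U) * plane G r (0, 1) (Pi.single (2 : Fin 4) (m : ℤ)) (torusLift T U)
        - (r.N : ℝ) * plane G r (0, 1) 0 (torusLift T U)
        - (r.N : ℝ) * plane G r (0, 1) (Pi.single (2 : Fin 4) (m : ℤ)) (torusLift T U))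
      (wilsonMeasure (d := 4) (L := T) r.ρ β) := i1.sub (iB.const_mul (r.N : ℝ))
  unfold wilsonExpectation
  rw [e1, e2, e3, integral_add i2 (integrable_const _), integral_sub i1 (iB.const_mul _),
    integral_sub iAB (iA.const_mul _), integral_const_mul, integral_const_mul, integral_const,
    integral_sub (integrable_const _) iA, integral_sub (integrable_const _) iB, integral_const]
  simp only [probReal_univ, smul_eq_mul, one_mul]
  ring

end Plane

/-! ### Geometry of the cube window -/

/-- The support of `plane q y` for a site `y` of the cube with `y ≤ c + b − 1` sits in the window `[c, c + b]`. [folklore] -/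
theorem plane_supp_window {c : Fin 4 → ℤ} {b : ℕ} (q : Fin 4 × Fin 4) {y : Fin 4 → ℤ}
    (hy : ∀ j, c j ≤ y j ∧ y j + 1 ≤ c j + b)
    (e : Literature.MathematicalPhysics.QuantumLattice.ZdEdge 4)
    (he : e ∈ (originPlaquetteSupport q.1 q.2).image fun e => (e.1 - -y, e.2)) (j : Fin 4) :
    c j ≤ e.1 j ∧ e.1 j ≤ c j + b := by
  have h := near_of_mem_supp_plane he j
  have := hy j
  constructor <;> linarith [h.1, h.2, this.1, this.2]

/-- A site of depth `≥ 1` in the cube `(c, b)` satisfies `c ≤ y` and `y + 1 ≤ c + b` coordinatewise. [folklore] -/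
theorem window_of_depth_pos {c : Fin 4 → ℤ} {b : ℕ} {y : Fin 4 → ℤ} (hy : 1 ≤ depth c b y) (j : Fin 4) :
    c j ≤ y j ∧ y j + 1 ≤ c j + b := by
  unfold depth at hy
  have h := (Finset.le_inf'_iff _ _).1 hy j (Finset.mem_univ j)
  rw [le_min_iff] at h
  obtain ⟨h1, h2⟩ := h
  have h1' : (1 : ℤ) ≤ y j - c j + 1 := by
    by_contra hc
    push Not at hc
    have : (y j - c j + 1).toNat = 0 := Int.toNat_eq_zero.2 (by linarith)
    omega
  have h2' : (1 : ℤ) ≤ c j + b - y j := by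
    by_contra hc
    push Not at hc
    have : (c j + b - y j).toNat = 0 := Int.toNat_eq_zero.2 (by linarith)
    omega
  constructor <;> linarith

/-! ### The one-cube torus DLR step for a general cube, and the two-sided total covariance estimate -/

section DLR

variable (G : Type) [Group G] [TopologicalSpace G] [IsTopologicalGroup G] [CompactSpace G]
  [MeasurableSpace G] [BorelSpace G] (r : LatticeRep G)

/-- **One-cube DLR step, general cube.**  For a bounded continuous cylinder observable `F` whose support is
based at sites `z` with `c ≤ z ≤ c + b` coordinatewise, and a torus of side `T ≥ b + 3`, the torus expectation
of `F ∘ lift` equals that of `(kerE_{(c,b)} F) ∘ lift` (Georgii 2011 (4.18) on the torus, window form). [folklore] -/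
theorem integral_lift_eq_integral_kerE_cube (β : ℝ) (c : Fin 4 → ℤ) (b T : ℕ) [NeZero T] (hT : b + 3 ≤ T)
    {F : LGConfig 4 G → ℝ} (hF : Continuous F) {C : ℝ} (hC : ∀ U, |F U| ≤ C)
    {S₀ : Finset (Literature.MathematicalPhysics.QuantumLattice.ZdEdge 4)} (hFS : IsCylinder F S₀)
    (hS₀ : ∀ e ∈ S₀, ∀ j, c j ≤ e.1 j ∧ e.1 j ≤ c j + b) :
    ∫ U, F (torusLift T U) ∂(wilsonMeasure (d := 4) (L := T) r.ρ β) =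
      ∫ U, kerE G r β c b (torusLift T U) F ∂(wilsonMeasure (d := 4) (L := T) r.ρ β) := by
  haveI := r.secondCountableTopology
  unfold kerE
  refine integral_torusLift_eq_integral_kernel r.ρ r.continuous β _ hF hC hFS T (fun j => c j - 1)
    fun e he j => ?_
  have hT' : (b : ℤ) + 3 ≤ T := by exact_mod_cast hT
  rcases Finset.mem_union.1 he with h1 | h2
  · have := (mem_cubeSites_iff _ _ _).1 (fst_mem_cubeSites_of_mem_cubeEdges h1) j
    constructor <;> linarith [this.1, this.2]
  · have := hS₀ e h2 j
    constructor <;> linarith [this.1, this.2]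

/-- **The two-sided law of total covariance for two plane fields of a cube, on a femto torus.**  If both sites
have depth `≥ 1` in the cube `(c, b)`, the torus has side `T ≥ b + 3`, and the one-point kernels obey the
boundary laws `|kerE_η (plane q y) − p| ≤ h`, `|kerE_η (plane q' y') − p'| ≤ h'` for every exterior, then
`|liftCov(plane q y, plane q' y') − ∫ kerCov_{lift U}(plane q y, plane q' y') dμ_T| ≤ 4 h h'`. [folklore] -/
theorem abs_liftCov_plane_sub_integral_kerCov_le (β : ℝ) (c : Fin 4 → ℤ) (b T : ℕ) [NeZero T]
    (hT : b + 3 ≤ T) (q q' : Fin 4 × Fin 4) {y y' : Fin 4 → ℤ} (hy : 1 ≤ depth c b y)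
    (hy' : 1 ≤ depth c b y') {p p' h h' : ℝ}
    (hby : ∀ η, |kerE G r β c b η (plane G r q y) - p| ≤ h)
    (hby' : ∀ η, |kerE G r β c b η (plane G r q' y') - p'| ≤ h') :
    |((∫ U, plane G r q y (torusLift T U) * plane G r q' y' (torusLift T U) ∂(wilsonMeasure (d := 4) (L := T) r.ρ β)) -
        (∫ U, plane G r q y (torusLift T U) ∂(wilsonMeasure (d := 4) (L := T) r.ρ β)) *
          (∫ U, plane G r q' y' (torusLift T U) ∂(wilsonMeasure (d := 4) (L := T) r.ρ β))) -
        ∫ U, kerCov G r β c b (torusLift T U) (plane G r q y) (plane G r q' y')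
          ∂(wilsonMeasure (d := 4) (L := T) r.ρ β)| ≤ 4 * h * h' := by
  haveI := r.secondCountableTopology
  haveI := isProbabilityMeasure_wilsonMeasure (d := 4) (L := T) r.ρ r.continuous β
  obtain ⟨C, hC⟩ := exists_abs_plane_le (G := G) r
  have hC0 : 0 ≤ C := (abs_nonneg _).trans (hC (0, 1) 0 1)
  have hcy := continuous_plane r q y
  have hcy' := continuous_plane r q' y'
  have hcyy' : Continuous fun U : LGConfig 4 G => plane G r q y U * plane G r q' y' U := hcy.mul hcy'
  have hbyy' : ∀ U, |plane G r q y U * plane G r q' y' U| ≤ C * C := fun U => by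
    rw [abs_mul]; exact mul_le_mul (hC _ _ U) (hC _ _ U) (abs_nonneg _) hC0
  have wy := plane_supp_window q (window_of_depth_pos hy)
  have wy' := plane_supp_window q' (window_of_depth_pos hy')
  -- the three DLR steps
  rw [integral_lift_eq_integral_kerE_cube G r β c b T hT hcy (hC q y) (isCylinder_plane r q y) wy,
    integral_lift_eq_integral_kerE_cube G r β c b T hT hcy' (hC q' y') (isCylinder_plane r q' y') wy',
    integral_lift_eq_integral_kerE_cube G r β c b T hT hcyy' hbyy'
      (isCylinder_mul (isCylinder_plane r q y) (isCylinder_plane r q' y'))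
      (fun e he j => by
        rcases Finset.mem_union.1 he with h1 | h2
        · exact wy e h1 j
        · exact wy' e h2 j)]
  -- continuity of the kernel means in the exterior
  have hk : ∀ {F : LGConfig 4 G → ℝ}, Continuous F → ∀ {C : ℝ}, (∀ U, |F U| ≤ C) →
      Continuous fun U : GaugeConfig 4 T G => kerE G r β c b (torusLift T U) F := by
    intro F hF C hC
    unfold kerE
    exact (continuous_integral_ymSpecification r.ρ r.continuous β _ hF hC).comp (continuous_torusLift _)
  have h := abs_cov_sub_integral_condCov_le (μ := wilsonMeasure (d := 4) (L := T) r.ρ β)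
    (hk hcy (hC q y)) (hk hcy' (hC q' y')) (hk hcyy' hbyy') (fun U => hby _) (fun U => hby' _)
  unfold kerCov
  exact h

/-- **Averaging the gate over the torus.**  If the conditional covariance of two plane fields of the cube is within
`Δ` of a constant `K` for EVERY exterior, then so is its torus average. [folklore] -/
theorem abs_integral_kerCov_plane_sub_le (β : ℝ) (c : Fin 4 → ℤ) (b T : ℕ) [NeZero T]
    (q q' : Fin 4 × Fin 4) (y y' : Fin 4 → ℤ) {K Δ : ℝ}
    (hK : ∀ η, |kerCov G r β c b η (plane G r q y) (plane G r q' y') - K| ≤ Δ) :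
    |(∫ U, kerCov G r β c b (torusLift T U) (plane G r q y) (plane G r q' y')
        ∂(wilsonMeasure (d := 4) (L := T) r.ρ β)) - K| ≤ Δ := by
  haveI := r.secondCountableTopology
  haveI := isProbabilityMeasure_wilsonMeasure (d := 4) (L := T) r.ρ r.continuous β
  obtain ⟨C, hC⟩ := exists_abs_plane_le (G := G) r
  have hC0 : 0 ≤ C := (abs_nonneg _).trans (hC (0, 1) 0 1)
  have hk : ∀ {F : LGConfig 4 G → ℝ}, Continuous F → ∀ {C : ℝ}, (∀ U, |F U| ≤ C) →
      Continuous fun U : GaugeConfig 4 T G => kerE G r β c b (torusLift T U) F := by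
    intro F hF C hC
    unfold kerE
    exact (continuous_integral_ymSpecification r.ρ r.continuous β _ hF hC).comp (continuous_torusLift _)
  have hcy := continuous_plane r q y
  have hcy' := continuous_plane r q' y'
  have hcyy' : Continuous fun U : LGConfig 4 G => plane G r q y U * plane G r q' y' U := hcy.mul hcy'
  have hbyy' : ∀ U, |plane G r q y U * plane G r q' y' U| ≤ C * C := fun U => by
    rw [abs_mul]; exact mul_le_mul (hC _ _ U) (hC _ _ U) (abs_nonneg _) hC0
  have hcont : Continuous fun U : GaugeConfig 4 T G =>
      kerCov G r β c b (torusLift T U) (plane G r q y) (plane G r q' y') := by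
    unfold kerCov
    exact (hk hcyy' hbyy').sub ((hk hcy (hC q y)).mul (hk hcy' (hC q' y')))
  exact abs_integral_sub_le_of_forall (μ := wilsonMeasure (d := 4) (L := T) r.ρ β) hcont fun U => hK _

end DLR

end StubInherit

/-! ### Registered sub-goal (closed form) -/

/-- **Two-sided law of total covariance for plane fields on a femto torus — registered sub-goal
`torusTotalCovariancePlane` of crux stmt-QuantumFields-16207 (line `inherited-amplitude-gates`, stub `stub_inherit`),
closed form of `StubInherit.abs_liftCov_plane_sub_integral_kerCov_le`.**  For every compact `G`, lattice representation
`r`, coupling `β`, cube `(c, b)`, torus side `T ≥ b + 3`, two plane fields at sites of depth `≥ 1` whose one-point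
kernels obey boundary laws `h, h'` for every exterior: the torus covariance of the lifted fields is within `4 h h'` of
the torus average of their conditional covariance. [folklore] -/
theorem torusTotalCovariancePlane : ∀ (G : Type) [Group G] [TopologicalSpace G] [IsTopologicalGroup G] [CompactSpace G] [MeasurableSpace G] [BorelSpace G] (r : LatticeRep G) (β : ℝ) (c : Fin 4 → ℤ) (b T : ℕ) [NeZero T], b + 3 ≤ T → ∀ (q q' : Fin 4 × Fin 4) (y y' : Fin 4 → ℤ), 1 ≤ depth c b y → 1 ≤ depth c b y' → ∀ (p p' h h' : ℝ), (∀ η : LGConfig 4 G, |kerE G r β c b η (plane G r q y) - p| ≤ h) → (∀ η : LGConfig 4 G, |kerE G r β c b η (plane G r q' y') - p'| ≤ h') → |((∫ U, plane G r q y (torusLift T U) * plane G r q' y' (torusLift T U) ∂(wilsonMeasure (d := 4) (L := T) r.ρ β)) - (∫ U, plane G r q y (torusLift T U) ∂(wilsonMeasure (d := 4) (L := T) r.ρ β)) * (∫ U, plane G r q' y' (torusLift T U) ∂(wilsonMeasure (d := 4) (L := T) r.ρ β))) - ∫ U, kerCov G r β c b (torusLift T U) (plane G r q y) (plane G r q'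 y') ∂(wilsonMeasure (d := 4) (L := T) r.ρ β)| ≤ 4 * h * h' := by
  intro G _ _ _ _ _ _ r β c b T _ hT q q' y y' hy hy' p p' h h' hby hby'
  exact StubInherit.abs_liftCov_plane_sub_integral_kerCov_le G r β c b T hT q q' hy hy' hby hby'

end Summit.QuantumFields.YangMills.Cruxes.OSLegsAtWeakCouplingC.InheritedAmplitudeGates

end
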